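import Literature.AlgebraicGeometry.HodgeTheory.SubvariationIrreducibleOfFlatSpan
import HarnessLib

/-!
# A sub-variation whose moving Hodge filtration has scalar stabiliser is irreducible under every
# finite-index monodromy subgroup (the cell's (C33) «STAB» criterion; Deligne 1987 §1.12–1.13)

Family `hodge`, layer `Literature/AlgebraicGeometry/HodgeTheory`; THEOREMS ONLY (no definition, no new
named fact). Companion of `SubvariationIrreducibleOfFlatSpan` (the rank-one «FS» criterion, which needs
`dim(M ∩ F^p) ≤ 1`): here the Hodge number `dim(M ∩ F^p)` is ARBITRARY, so the criterion serves the cell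
`hodge-nonav`'s crux K1Q (route `HodgeConjecture/Q8SymplecticPowers`, memo `ROUTE-P3v28-g37.md` §7 (C33))
uniformly in the degree parameter `e` (where `dim(ker(τ* − i) ∩ H^{2,0}) = e(e−2)/8`).

STATEMENT (`isTransportIrreducible_of_stabilizer_scalar`): `f : 𝒳 → S` smooth projective of relative
dimension `n` over a smooth quasi-projective `S`, `Rᵏ f_* ℂ` locally trivial (`hU`), Hodge models `A t`,
base point `s`, `H ≤ π₁(S(ℂ), s)` of finite index, `M ⊆ Hᵏ(X_s(ℂ); ℂ)` a non-zero `H`-stable complex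
SUB-VARIATION; HYPOTHESIS (STAB)_s: every `ℂ`-linear endomorphism `φ` of `ℂ ⊗_ℚ Hᵏ(X_s; ℚ)` mapping `β_s⁻¹M`
into itself and `β_s⁻¹M ∩ F^p(t,T)` into `F^p(t,T)` for EVERY member `t`, path class `γ : s ⇝ t` and
rational transport `T` along `γ` (`F^p(t,T)` = the Hodge filtration of `X_t` pulled back to `s` by `T`) acts
on `β_s⁻¹M` as a scalar. CONCLUSION: `M` is `H`-irreducible — granted FACT B
(`deligne1987_monodromy_directSum_irreducible_subvariations`, Deligne 1987 Prop. 1.13).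

PROOF (no holomorphy, no constancy of Hodge numbers): were `M` reducible, Deligne's complete reducibility
by sub-variations (`exists_proper_subvariation_of_reducible_le` contrapositive,
`exists_isCompl_subvariation(_le)`) splits `M = K ⊕ K'` inside `Hᵏ = M ⊕ M'` by `H`-stable sub-variations;
at EVERY continuation the three pulled-back pieces are compatible with the pulled-back Hodge structure
(`comap_eq_iSup_inf_piece_comapEquiv_of_isHodgeSubspace_map`), so
`β⁻¹M ∩ F^p(t,T) = (β⁻¹K ∩ F^p) ⊕ (β⁻¹K' ∩ F^p)` (`HodgeStructure.sup_inf_F_eq_of_splitting`); hence the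
projector onto `β⁻¹K` along `β⁻¹K' ⊕ β⁻¹M'` satisfies the hypothesis of (STAB)_s and is a scalar `c` on
`β⁻¹M`: `c = 1` on `β⁻¹K ≠ 0` and `c = 0` on `β⁻¹K' ≠ 0` — contradiction.

CERTIFICATE SHAPE: (STAB)_s follows from any FINITE family of continuations `(t_k, T_k)` whose subspaces
`β⁻¹M ∩ F^p(t_k, T_k)` have joint stabiliser `ℂ · id` inside `End(β⁻¹M)` (fewer constraints, more `φ`);
this is the planner's STAB_N, decided by finitely many members.

Also: `eq_bot_or_eq_of_stable_of_stabilizer_scalar` — the same in the currency of the cell's stub (subspace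
`Mi ⊆ ℂ ⊗_ℚ Hᵏ(X_s; ℚ)`, finite-index `Γ' ≤ ratMonodromyGroup` acting by `γ ⊗ ℂ`).

## References
* [Deligne1987] P. Deligne, Un théorème de finitude pour la monodromie, Progr. Math. 67 (1987), §1.11–1.13.
* [VoisinHodgeI2002] C. Voisin, Hodge Theory and Complex Algebraic Geometry I, CUP 2002, §7.1.1
  (Hodge structures and sub-structures), §10.2 (variations).
-/

noncomputable section

open CategoryTheory AlgebraicGeometry
open _root_.Topology _root_.Filter Set Module Submodule
open scoped TensorProduct
open Literature.AlgebraicTopology.SingularHomology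
open Literature.AlgebraicGeometry.Motives

namespace Literature.AlgebraicGeometry.HodgeTheory

section HodgeTheory

variable {𝒳 S : SchemeOver ℂ}

/-- **(STAB)_s ⇒ irreducibility under every finite-index monodromy subgroup** (see the module docstring).
[cite: Deligne1987, §1.12–1.13 (p. 10–11)] [cite: VoisinHodgeI2002, §7.1.1] -/
theorem isTransportIrreducible_of_stabilizer_scalar
    (h : deligne1987_monodromy_directSum_irreducible_subvariations)
    (f : 𝒳 ⟶ S) (n k : ℕ)
    (hf : IsSmoothProjectiveFamily f n) (hS : IsQuasiProjectiveOver S) (hSm : Smooth S.hom)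
    (hU : IsCohomologicallyLocallyTrivialOn f (Set.univ : Set (ComplexPoints S)))
    (A : ∀ t : ComplexPoints S, HodgeModel n (fiberOver f t)) (hA : ∀ t, (A t).IsHodgeSymmetric)
    (s : (Set.univ : Set (ComplexPoints S)))
    {H : Subgroup (FundamentalGroup (Set.univ : Set (ComplexPoints S)) s)} (hH : H.FiniteIndex)
    {M : Submodule ℂ (complexBetti (fiberOver f s.1) k)}
    (hMs : IsTransportStable f k hU s H M) (hMv : IsSubvariation f k hU n s M) (hM0 : M ≠ ⊥)
    (p : ℤ)
    (hSTAB : ∀ φ : (ℂ ⊗[ℚ] singularCohomology ℚ ℚ (ComplexPoints (fiberOver f s.1)) k) →ₗ[ℂ]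
        (ℂ ⊗[ℚ] singularCohomology ℚ ℚ (ComplexPoints (fiberOver f s.1)) k),
      (∀ x ∈ M.comap (ofRatClassBaseChangeEquiv (hf.isSmoothProjective s.1) k).toLinearMap,
        φ x ∈ M.comap (ofRatClassBaseChangeEquiv (hf.isSmoothProjective s.1) k).toLinearMap) →
      (∀ (t : (Set.univ : Set (ComplexPoints S))) (γ : Path.Homotopic.Quotient s t)
        (T : singularCohomology ℚ ℚ (ComplexPoints (fiberOver f s.1)) k ≃ₗ[ℚ]
          singularCohomology ℚ ℚ (ComplexPoints (fiberOver f t.1)) k),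
        (∀ v, ofRatClass _ k (T v) = transportFun f k hU γ (ofRatClass _ k v)) →
        ∀ x ∈ M.comap (ofRatClassBaseChangeEquiv (hf.isSmoothProjective s.1) k).toLinearMap ⊓
            (((A t.1).hodgeStructure (hf.isSmoothProjective t.1) (hA t.1) k).comapEquiv T).F p,
          φ x ∈ (((A t.1).hodgeStructure (hf.isSmoothProjective t.1) (hA t.1) k).comapEquiv T).F p) →
      ∃ c : ℂ, ∀ x ∈ M.comap (ofRatClassBaseChangeEquiv (hf.isSmoothProjective s.1) k).toLinearMap,
        φ x = c • x) :
    IsTransportIrreducible f k hU s H M := by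
  classical
  have hXs : IsSmoothProjective n (fiberOver f s.1) := hf.isSmoothProjective s.1
  set e := ofRatClassBaseChangeEquiv (hf.isSmoothProjective s.1) k with he
  set φo : Submodule ℂ (complexBetti (fiberOver f s.1) k) ≃o
      Submodule ℂ (ℂ ⊗[ℚ] singularCohomology ℚ ℚ (ComplexPoints (fiberOver f s.1)) k) :=
    (Submodule.orderIsoMapComap e).symm with hφo
  have hφX : ∀ X : Submodule ℂ (complexBetti (fiberOver f s.1) k),
      φo X = X.comap e.toLinearMap := fun X ↦ rfl
  refine deligne1987_monodromy_directSum_irreducible_subvariations.isTransportIrreducible_of_forall_subvariation_eq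
    h hf hS hSm hU hH hMs hMv hM0 fun K hKM hKs hKv ↦ ?_
  by_contra hne
  push Not at hne
  obtain ⟨hK0, hKM'⟩ := hne
  -- complements: `K ⊕ K' = M`, `M ⊕ M' = Hᵏ`, all `H`-stable sub-variations
  obtain ⟨K', hK'M, hKK', hKsup, hK's, hK'v⟩ :=
    deligne1987_monodromy_directSum_irreducible_subvariations.exists_isCompl_subvariation_le
      h hf hS hSm hU hH hKM hKs hMs hMv
  obtain ⟨M', hMM', hM's, hM'v⟩ :=
    deligne1987_monodromy_directSum_irreducible_subvariations.exists_isCompl_subvariation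
      h hf hS hSm hU hH hMs
  -- the three pieces read on `ℂ ⊗_ℚ Hᵏ(X_s; ℚ)`
  set K₀ := K.comap e.toLinearMap with hK₀
  set K₁ := K'.comap e.toLinearMap with hK₁
  set K₂ := M'.comap e.toLinearMap with hK₂
  have hM01 : M.comap e.toLinearMap = K₀ ⊔ K₁ := by
    rw [hK₀, hK₁, ← hφX, ← hφX, ← hφX, ← hKsup]
    exact φo.map_sup K K'
  have hdis₀₁ : Disjoint K₀ K₁ := by
    rw [hK₀, hK₁, ← hφX, ← hφX]
    exact hKK'.map_orderIso φo
  have hdis : Disjoint (K₀ ⊔ K₁) K₂ := by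
    rw [← hM01, hK₂, ← hφX, ← hφX]
    exact hMM'.disjoint.map_orderIso φo
  have htop : (K₀ ⊔ K₁) ⊔ K₂ = ⊤ := by
    rw [← hM01, hK₂, ← hφX, ← hφX, ← φo.map_sup, hMM'.sup_eq_top]
    exact map_top φo
  -- `K₀` and `K₁ ⊔ K₂` are complementary
  have hc : IsCompl K₀ (K₁ ⊔ K₂) := by
    refine ⟨?_, ?_⟩
    · exact hdis₀₁.disjoint_sup_right_of_disjoint_sup_left hdis
    · rw [codisjoint_iff, ← sup_assoc, htop]
  -- the projector onto `K₀` along `K₁ ⊔ K₂`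
  set π₀ : (ℂ ⊗[ℚ] singularCohomology ℚ ℚ (ComplexPoints (fiberOver f s.1)) k) →ₗ[ℂ]
      (ℂ ⊗[ℚ] singularCohomology ℚ ℚ (ComplexPoints (fiberOver f s.1)) k) :=
    K₀.projection (K₁ ⊔ K₂) hc with hπ₀
  have hπ₀K : ∀ x ∈ K₀, π₀ x = x := fun x hx ↦ Submodule.projection_apply_of_mem_left hc hx
  have hπ₀0 : ∀ x ∈ K₁ ⊔ K₂, π₀ x = 0 := fun x hx ↦ Submodule.projection_apply_of_mem_right hc hx
  have hπ₀mem : ∀ x, π₀ x ∈ K₀ := fun x ↦ Submodule.projection_apply_mem hc x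
  -- `π₀` preserves `β⁻¹M`
  have hπ₀M : ∀ x ∈ M.comap e.toLinearMap, π₀ x ∈ M.comap e.toLinearMap := fun x _ ↦ by
    rw [hM01]
    exact Submodule.mem_sup_left (hπ₀mem x)
  -- Hodge compatibility of the three pieces at every continuation
  have hKpiece : ∀ (t : (Set.univ : Set (ComplexPoints S))) (γ : Path.Homotopic.Quotient s t)
      (T : singularCohomology ℚ ℚ (ComplexPoints (fiberOver f s.1)) k ≃ₗ[ℚ]
        singularCohomology ℚ ℚ (ComplexPoints (fiberOver f t.1)) k),
      (∀ v, ofRatClass _ k (T v) = transportFun f k hU γ (ofRatClass _ k v)) →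
      ∀ L : Submodule ℂ (complexBetti (fiberOver f s.1) k), IsSubvariation f k hU n s L →
        L.comap e.toLinearMap = ⨆ q : ℤ, L.comap e.toLinearMap ⊓
          (((A t.1).hodgeStructure (hf.isSmoothProjective t.1) (hA t.1) k).comapEquiv T).piece q
            ((k : ℤ) - q) :=
    fun t γ T hT L hL ↦ comap_eq_iSup_inf_piece_comapEquiv_of_isHodgeSubspace_map hT hXs
      (hf.isSmoothProjective t.1) (A t.1) (hA t.1) (hL t γ)
  -- `π₀` preserves `β⁻¹M ∩ F^p(t,T)` at every continuation
  have hπ₀F : ∀ (t : (Set.univ : Set (ComplexPoints S))) (γ : Path.Homotopic.Quotient s t)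
      (T : singularCohomology ℚ ℚ (ComplexPoints (fiberOver f s.1)) k ≃ₗ[ℚ]
        singularCohomology ℚ ℚ (ComplexPoints (fiberOver f t.1)) k),
      (∀ v, ofRatClass _ k (T v) = transportFun f k hU γ (ofRatClass _ k v)) →
      ∀ x ∈ M.comap e.toLinearMap ⊓
          (((A t.1).hodgeStructure (hf.isSmoothProjective t.1) (hA t.1) k).comapEquiv T).F p,
        π₀ x ∈ (((A t.1).hodgeStructure (hf.isSmoothProjective t.1) (hA t.1) k).comapEquiv T).F p := by
    intro t γ T hT x hx
    have hsplit : M.comap e.toLinearMap ⊓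
        (((A t.1).hodgeStructure (hf.isSmoothProjective t.1) (hA t.1) k).comapEquiv T).F p =
        K₀ ⊓ (((A t.1).hodgeStructure (hf.isSmoothProjective t.1) (hA t.1) k).comapEquiv T).F p ⊔
          K₁ ⊓ (((A t.1).hodgeStructure (hf.isSmoothProjective t.1) (hA t.1) k).comapEquiv T).F p := by
      rw [hM01]
      exact HodgeStructure.sup_inf_F_eq_of_splitting _ K₀ K₁ K₂ htop hdis
        (hKpiece t γ T hT K hKv) (hKpiece t γ T hT K' hK'v) (hKpiece t γ T hT M' hM'v) p
    rw [hsplit] at hx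
    obtain ⟨a, ha, b, hb, rfl⟩ := Submodule.mem_sup.1 hx
    rw [map_add, hπ₀K a ha.1, hπ₀0 b (Submodule.mem_sup_left hb.1), add_zero]
    exact ha.2
  -- (STAB): `π₀ = c • id` on `β⁻¹M`
  obtain ⟨c, hc'⟩ := hSTAB π₀ hπ₀M hπ₀F
  -- `c = 1` on `K₀ ≠ 0`, `c = 0` on `K₁ ≠ 0`
  have hK₀ne : K₀ ≠ ⊥ := by
    rw [hK₀, ← hφX]
    exact fun h0 ↦ hK0 (φo.injective (h0.trans (map_bot φo).symm))
  have hK₁ne : K₁ ≠ ⊥ := by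
    rw [hK₁, ← hφX]
    intro h0
    have hK'0 : K' = ⊥ := φo.injective (h0.trans (map_bot φo).symm)
    apply hKM'
    rw [← hKsup, hK'0, sup_bot_eq]
  obtain ⟨a, haK, ha0⟩ := Submodule.exists_mem_ne_zero_of_ne_bot hK₀ne
  obtain ⟨b, hbK, hb0⟩ := Submodule.exists_mem_ne_zero_of_ne_bot hK₁ne
  have ha1 : π₀ a = c • a := hc' a (by rw [hM01]; exact Submodule.mem_sup_left haK)
  have hb1 : π₀ b = c • b := hc' b (by rw [hM01]; exact Submodule.mem_sup_right hbK)
  rw [hπ₀K a haK] at ha1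
  rw [hπ₀0 b (Submodule.mem_sup_left hbK)] at hb1
  -- from `a = c • a`, `a ≠ 0`: `c = 1`; then `0 = b`, contradiction
  have hc1 : c = 1 := by
    by_contra hc1
    apply ha0
    have : (1 - c) • a = 0 := by rw [sub_smul, one_smul, ← ha1, sub_self]
    rcases smul_eq_zero.1 this with h1 | h1
    · exact absurd (sub_eq_zero.1 h1).symm hc1
    · exact h1
  rw [hc1, one_smul] at hb1
  exact hb0 hb1.symm

/-- **The (STAB) criterion in the currency of the cell's stub S4 (iii)** (`ℂ ⊗_ℚ Hᵏ(X_s; ℚ)`, finite-index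
subgroups `Γ'` of the rational monodromy group acting through `γ ⊗ ℂ`): `Mi ⊆ ℂ ⊗_ℚ Hᵏ(X_s; ℚ)` non-zero,
`Γ'`-stable, with `β_s Mi` a complex sub-variation, and (STAB)_s for `Mi` ⇒ every `Γ'`-stable `F ⊆ Mi` is
`0` or `Mi`. [cite: Deligne1987, §1.12–1.13 (p. 10–11)] [cite: VoisinHodgeI2002, §7.1.1] -/
theorem eq_bot_or_eq_of_stable_of_stabilizer_scalar
    (h : deligne1987_monodromy_directSum_irreducible_subvariations)
    (f : 𝒳 ⟶ S) (n k d : ℕ)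
    (hf : IsSmoothProjectiveFamily f n) (hS : IsQuasiProjectiveOver S)
    [AlgebraicGeometry.SmoothOfRelativeDimension d S.hom]
    (hU : IsCohomologicallyLocallyTrivialOn f (Set.univ : Set (ComplexPoints S)))
    (A : ∀ t : ComplexPoints S, HodgeModel n (fiberOver f t)) (hA : ∀ t, (A t).IsHodgeSymmetric)
    (s : (Set.univ : Set (ComplexPoints S)))
    {Mi : Submodule ℂ (ℂ ⊗[ℚ] bettiCohomology (fiberOver f s.1) k)}
    (hMv : IsSubvariation f k hU n s
      (Mi.map (ofRatClassBaseChangeEquiv (hf.isSmoothProjective s.1) k).toLinearMap))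
    (hM0 : Mi ≠ ⊥) (p : ℤ)
    (hSTAB : ∀ φ : (ℂ ⊗[ℚ] bettiCohomology (fiberOver f s.1) k) →ₗ[ℂ]
        (ℂ ⊗[ℚ] bettiCohomology (fiberOver f s.1) k),
      (∀ x ∈ Mi, φ x ∈ Mi) →
      (∀ (t : (Set.univ : Set (ComplexPoints S))) (γ : Path.Homotopic.Quotient s t)
        (T : bettiCohomology (fiberOver f s.1) k ≃ₗ[ℚ] bettiCohomology (fiberOver f t.1) k),
        (∀ v, ofRatClass _ k (T v) = transportFun f k hU γ (ofRatClass _ k v)) →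
        ∀ x ∈ Mi ⊓ (((A t.1).hodgeStructure (hf.isSmoothProjective t.1) (hA t.1) k).comapEquiv T).F p,
          φ x ∈ (((A t.1).hodgeStructure (hf.isSmoothProjective t.1) (hA t.1) k).comapEquiv T).F p) →
      ∃ c : ℂ, ∀ x ∈ Mi, φ x = c • x)
    {Γ' : Subgroup (bettiCohomology (fiberOver f s.1) k ≃ₗ[ℚ] bettiCohomology (fiberOver f s.1) k)}
    (hfi : (Γ'.subgroupOf (ratMonodromyGroup f k hU s)).FiniteIndex)
    (hstab : ∀ γ ∈ Γ', ∀ x ∈ Mi, ((γ : _ →ₗ[ℚ] _).baseChange ℂ) x ∈ Mi)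
    (F : Submodule ℂ (ℂ ⊗[ℚ] bettiCohomology (fiberOver f s.1) k)) (hFM : F ≤ Mi)
    (hFstab : ∀ γ ∈ Γ', ∀ x ∈ F, ((γ : _ →ₗ[ℚ] _).baseChange ℂ) x ∈ F) :
    F = ⊥ ∨ F = Mi := by
  haveI : Smooth S.hom := AlgebraicGeometry.SmoothOfRelativeDimension.smooth d S.hom
  set e := ofRatClassBaseChangeEquiv (hf.isSmoothProjective s.1) k with he
  have hrat : ∀ (a b : (Set.univ : Set (ComplexPoints S))) (γ : Path.Homotopic.Quotient a b)
      (α : complexBetti (fiberOver f a.1) k),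
      IsRationalClass α → IsRationalClass (transportFun f k hU γ α) :=
    fun _ _ γ _ hα ↦ isRationalClass_transportFun_of_isSmoothProjectiveFamily (f := f) (k := k) d hf hS γ hα
  set H := Γ'.comap (ratMonodromyRep f k hU hrat s) with hH
  have hHfi : H.FiniteIndex := finiteIndex_comap_ratMonodromyRep f k hU hrat s hfi
  have hMs : IsTransportStable f k hU s H (Mi.map e.toLinearMap) :=
    isTransportStable_map_of_forall_baseChange_mem f n k d hf hS hU s hstab
  have hFs : IsTransportStable f k hU s H (F.map e.toLinearMap) :=
    isTransportStable_map_of_forall_baseChange_mem f n k d hf hS hU s hFstab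
  have hcm : (Mi.map e.toLinearMap).comap e.toLinearMap = Mi :=
    Submodule.comap_map_eq_of_injective e.injective Mi
  have hirr : IsTransportIrreducible f k hU s H (Mi.map e.toLinearMap) := by
    refine isTransportIrreducible_of_stabilizer_scalar h f n k hf hS inferInstance hU A hA s hHfi hMs hMv
      (fun h0 ↦ hM0 ((Submodule.map_eq_bot_iff (e := e)).1 h0)) p ?_
    rw [hcm]
    exact hSTAB
  rcases hirr.2 (F.map e.toLinearMap) (Submodule.map_mono hFM) hFs with h0 | h1
  · exact Or.inl ((Submodule.map_eq_bot_iff (e := e)).1 h0)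
  · exact Or.inr (Submodule.map_injective_of_injective e.injective h1)

end HodgeTheory

end Literature.AlgebraicGeometry.HodgeTheory

end
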